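import Literature.NumberTheory.EllipticCurves.PAdicLFunction
import Literature.NumberTheory.DiophantineGeometry.TateAlgorithm
import HarnessLib

/-!
# REVIEW-RUNBOOK sanity lemmas — the values `plusPeriod`, `minusPeriod`, `ratPlusSymbol`, `divPow` CHOOSE are DETERMINED
# (clients `bsd-wall`, `pub-bsdres`, `pub-bsdres-corners`, `bsd-goldfeld`, `bsd-cn100` of the ops review-runbook generator;
# §2 cards «Conventional values in reach», operation `Exists.choose`)

Each of these definitions is `if h : ∃ x, P x then h.choose else 0`.  Lean's `Exists.choose` returns SOME witness of `P`;
the value is well defined exactly when `P` has at most one witness.  This file proves that uniqueness for the four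
predicates, with the predicate written as in the definition:

* `plusPeriod f` / `minusPeriod f`: `P Ω := 0 < Ω ∧ re Λ_f = ℤ·(Ω/2)` (resp. `im Λ_f`) — a non-zero real number generating a
  given infinite cyclic subgroup of `ℝ` is determined up to sign, and the sign is fixed by `0 < Ω`;
* `ratPlusSymbol f r`: `P q := (q : ℝ) = [r]⁺_f` — `ℚ → ℝ` is injective;
* `divPow a j` (Tate's algorithm, `π^{-j} a`): `P c := a = π ^ j * c` — cancellation of the non-zero `π ^ j` in a domain.

Review evidence only (topic module, closes no item); no definitions, no `sorry`, standard axioms.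
-/

namespace Summit.BirchSwinnertonDyer.Rank1Residual.Runbook

open Literature.NumberTheory.EllipticCurves Literature.NumberTheory.EllipticCurves.ModularForms
open scoped MatrixGroups

/-- (c) **`plusPeriod` is well defined**: the predicate `0 < Ω ∧ realPeriods f = ℤ·(Ω/2)` it chooses from has at most
ONE witness — any two admissible `Ω`, `Ω'` are equal (a generator of an infinite cyclic subgroup of `ℝ` is determined up
to sign, `AddSubgroup.zmultiples_eq_zmultiples_iff`; the tree's `Rank2.LevelFifteen.eq_of_zmultiples_eq` is the same
remark for level 15). [folklore] -/
theorem plusPeriod_spec_unique {N : ℕ} (f : CuspForm (CongruenceSubgroup.Gamma0 N) 2) (Ω Ω' : ℝ)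
    (h : 0 < Ω ∧ realPeriods f = AddSubgroup.zmultiples (Ω / 2))
    (h' : 0 < Ω' ∧ realPeriods f = AddSubgroup.zmultiples (Ω' / 2)) : Ω = Ω' := by
  have hzm := h.2.symm.trans h'.2
  rw [AddSubgroup.zmultiples_eq_zmultiples_iff
    (not_isOfFinAddOrder_of_isAddTorsionFree (half_pos h.1).ne')] at hzm
  rcases hzm with hzm | hzm <;> linarith [h.1, h'.1]

/-- (c) **`minusPeriod` is well defined**: the predicate `0 < Ω ∧ imagPeriods f = ℤ·(Ω/2)` has at most ONE witness. [folklore] -/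
theorem minusPeriod_spec_unique {N : ℕ} (f : CuspForm (CongruenceSubgroup.Gamma0 N) 2) (Ω Ω' : ℝ)
    (h : 0 < Ω ∧ imagPeriods f = AddSubgroup.zmultiples (Ω / 2))
    (h' : 0 < Ω' ∧ imagPeriods f = AddSubgroup.zmultiples (Ω' / 2)) : Ω = Ω' := by
  have hzm := h.2.symm.trans h'.2
  rw [AddSubgroup.zmultiples_eq_zmultiples_iff
    (not_isOfFinAddOrder_of_isAddTorsionFree (half_pos h.1).ne')] at hzm
  rcases hzm with hzm | hzm <;> linarith [h.1, h'.1]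

/-- (c) **`ratPlusSymbol` is well defined**: the predicate `(q : ℝ) = normalizedPlusSymbol f r` has at most ONE rational
witness (the cast `ℚ → ℝ` is injective). [folklore] -/
theorem ratPlusSymbol_spec_unique {N : ℕ} (f : CuspForm (CongruenceSubgroup.Gamma0 N) 2) (r : ℚ) (q q' : ℚ)
    (hq : (q : ℝ) = normalizedPlusSymbol f r) (hq' : (q' : ℝ) = normalizedPlusSymbol f r) : q = q' := by
  exact_mod_cast hq.trans hq'.symm

/-- (c) **`divPow` is well defined** (Tate's algorithm `π^{-j} a`): the quotient `c` with `a = π ^ j * c` is UNIQUE —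
`R` is a domain and the uniformiser `π = uniformizer R` is irreducible, hence `π ^ j ≠ 0`. [folklore] -/
theorem divPow_spec_unique {R : Type*} [CommRing R] [IsDomain R] [IsDiscreteValuationRing R] (a : R) (j : ℕ)
    (c c' : R) (hc : a = Literature.NumberTheory.DiophantineGeometry.TateAlgorithm.uniformizer R ^ j * c)
    (hc' : a = Literature.NumberTheory.DiophantineGeometry.TateAlgorithm.uniformizer R ^ j * c') : c = c' :=
  mul_left_cancel₀
    (pow_ne_zero j (Literature.NumberTheory.DiophantineGeometry.TateAlgorithm.irreducible_uniformizer (R := R)).ne_zero)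
    (hc.symm.trans hc')

end Summit.BirchSwinnertonDyer.Rank1Residual.Runbook
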